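import Mathlib
import Summits.ValiantsHypothesis.ValiantsHypothesis.Theorems.MonotoneRestorationOrbitRestorationQPRowColumnStratum
import HarnessLib

/-!
# Two-level row/column polynomials are orbit-restorable (ORBIT currency)

Route MonotoneRestoration, crux `OrbitRestorationQP` (stmt-ValiantsHypothesis-18293), line `depth-three-rung`, registered stub
`stub_sigmaPiSigmaValue` (A_∞).  Namespace `Summit.ValiantsHypothesis.ValiantsHypothesis.Theorems.RowColumnTwoLevel`.  Definition-free.
The sub-quadratic stratum (`Theorems/…RowColumnStratum.lean`) restores the matrix-symmetric elements of `ℂ[r, c]`; here the row sum is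
replaced by an ARBITRARY symmetric function of the row: for symmetric `g, g' ∈ ℂ[y]` put `v_i = g(row i)`, `w_j = g'(column j)`.
* `exists_supported_of_mem_adjoin`, `exists_supported_sum` — **SUPPORTED CLOSURE**: polynomial expressions / sums of values with
  value derivations whose values are fixed by pointwise stabilisers of `≤ k` indices (Dawar–Wilsenach supports) again have such
  derivations;
* `rowPowerSum_supported`, `twoLevel_powerSum_qpOrbitRestorable` (+ column versions) — `Σ_j x_ij^m` has supports `≤ 2`; for a
  family `v` with `σ · v_i = v_{σ i}`, `v_i ∈ ℂ[Σ_j x_ij^m : m]`, every `Σ_i v_i^e` is `QPOrbitRestorable 9 n`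
  (`ValueOrbit.qpOrbit_of_supportedDerivation`: orbit `≤ (n+1)^8 ≤ 2^((log₂ n + 9)^9)`);
* `qpOrbitRestorable_twoLevel` — **THE TWO-LEVEL ROW/COLUMN STRATUM**: every MATRIX-SYMMETRIC element of
  `ℂ[g(row_1), …, g(row_n), g'(col_1), …, g'(col_n)]` is `QPOrbitRestorable 12 n` (one-block symmetrisation
  `RowColumnStratum.mem_adjoin_esymm_of_symmetric` twice, fundamental theorem + Newton, flat-cost closure).
Calibration: unconditional, VH-free; contains the `ℂ[r, c]` stratum (`g = g' = e_1`); the representation `p = F(v, w)` may be completely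
asymmetric.  Nothing here bears on VP ≠ VNP. [folklore] [cite: DawarWilsenach2025, §3.3, Def. 6.1]
-/

noncomputable section

open scoped Classical

-- `Summit.ValiantsHypothesis.ValiantsHypothesis.…` is the tree's single-conjunct layout (Sub = Summit).
set_option linter.dupNamespace false

namespace Summit.ValiantsHypothesis.ValiantsHypothesis.Theorems

namespace RowColumnTwoLevel

open MvPolynomial Equiv Literature.Computability.AlgebraicComplexity OrbitRestorationQPDepthThreeRung

variable {n : ℕ}

/-! ### Supported value derivations: closure under polynomial expressions and sums -/

/-- **SUPPORTED CLOSURE.**  If every `t ∈ T` is fixed by the pointwise stabiliser of `A` (`|A| ≤ k`) and is a value of a derivation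
all of whose values are fixed by the pointwise stabiliser of `≤ k` indices, then so is every element of `ℂ[T]`. [folklore] -/
theorem exists_supported_of_mem_adjoin {k : ℕ} (A : Finset (Fin n)) (hA : A.card ≤ k)
    {T : Set (MvPolynomial (Fin n × Fin n) ℂ)}
    (hT : ∀ t ∈ T, (∀ σ : Perm (Fin n), (∀ i ∈ A, σ i = i) → ren σ t = t) ∧
      ∃ 𝒟 : ValueDerivation ℂ (Fin n × Fin n), t ∈ 𝒟.S ∧ ∀ q ∈ 𝒟.S, ∃ T' : Finset (Fin n), T'.card ≤ k ∧
        ∀ σ : Perm (Fin n), (∀ i ∈ T', σ i = i) → ren σ q = q)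
    {p : MvPolynomial (Fin n × Fin n) ℂ} (hp : p ∈ Algebra.adjoin ℂ T) :
    (∀ σ : Perm (Fin n), (∀ i ∈ A, σ i = i) → ren σ p = p) ∧
      ∃ 𝒟 : ValueDerivation ℂ (Fin n × Fin n), p ∈ 𝒟.S ∧ ∀ q ∈ 𝒟.S, ∃ T' : Finset (Fin n), T'.card ≤ k ∧
        ∀ σ : Perm (Fin n), (∀ i ∈ T', σ i = i) → ren σ q = q := by
  induction hp using Algebra.adjoin_induction with
  | mem t ht => exact hT t ht
  | algebraMap r =>
    rw [MvPolynomial.algebraMap_eq]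
    have hfix : ∀ σ : Perm (Fin n), ren σ (C r : MvPolynomial (Fin n × Fin n) ℂ) = C r := fun σ => ren_C σ r
    refine ⟨fun σ _ => hfix σ, ⟨{C r}, fun _ => 0, fun q hq => ⟨StepData.const r, ⟨?_, fun u hu => ?_⟩⟩⟩,
      Finset.mem_singleton_self _, fun q hq => ⟨∅, by simp, fun σ _ => ?_⟩⟩
    · rw [Finset.mem_singleton.1 hq]; rfl
    · exact absurd hu (Multiset.notMem_zero u)
    · rw [Finset.mem_singleton.1 hq]; exact hfix σ
  | add x y hx hy ihx ihy =>
    obtain ⟨hxi, 𝒟₁, hx1, hS1⟩ := ihx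
    obtain ⟨hyi, 𝒟₂, hy2, hS2⟩ := ihy
    have hfix : ∀ σ : Perm (Fin n), (∀ i ∈ A, σ i = i) → ren σ (x + y) = x + y := fun σ hσ => by
      rw [map_add, hxi σ hσ, hyi σ hσ]
    have hx' : x ∈ (𝒟₁.union 𝒟₂).S := ValueDerivation.mem_union_S_left hx1
    have hy' : y ∈ (𝒟₁.union 𝒟₂).S := ValueDerivation.mem_union_S_right hy2
    refine ⟨hfix, (𝒟₁.union 𝒟₂).addStep x y hx' hy', ValueDerivation.mem_addStep_S.2 (Or.inl rfl), ?_⟩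
    intro r hr
    rcases ValueDerivation.mem_addStep_S.1 hr with rfl | hr
    · exact ⟨A, hA, hfix⟩
    rcases ValueDerivation.mem_union_S.1 hr with hr | hr
    · exact hS1 r hr
    · exact hS2 r hr
  | mul x y hx hy ihx ihy =>
    obtain ⟨hxi, 𝒟₁, hx1, hS1⟩ := ihx
    obtain ⟨hyi, 𝒟₂, hy2, hS2⟩ := ihy
    have hfix : ∀ σ : Perm (Fin n), (∀ i ∈ A, σ i = i) → ren σ (x * y) = x * y := fun σ hσ => by
      rw [map_mul, hxi σ hσ, hyi σ hσ]
    have hx' : x ∈ (𝒟₁.union 𝒟₂).S := ValueDerivation.mem_union_S_left hx1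
    have hy' : y ∈ (𝒟₁.union 𝒟₂).S := ValueDerivation.mem_union_S_right hy2
    refine ⟨hfix, (𝒟₁.union 𝒟₂).mulStep x y hx' hy', ValueDerivation.mem_mulStep_S.2 (Or.inl rfl), ?_⟩
    intro r hr
    rcases ValueDerivation.mem_mulStep_S.1 hr with rfl | hr
    · exact ⟨A, hA, hfix⟩
    rcases ValueDerivation.mem_union_S.1 hr with hr | hr
    · exact hS1 r hr
    · exact hS2 r hr

/-- Folding unions: one derivation containing the values of finitely many. [folklore] -/
theorem exists_union_derivation {ι : Type*} (s : Finset ι) (𝒟 : ι → ValueDerivation ℂ (Fin n × Fin n)) :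
    ∃ 𝒰 : ValueDerivation ℂ (Fin n × Fin n), (∀ j ∈ s, ∀ q ∈ (𝒟 j).S, q ∈ 𝒰.S) ∧
      (∀ q ∈ 𝒰.S, ∃ j ∈ s, q ∈ (𝒟 j).S) := by
  induction s using Finset.induction_on with
  | empty =>
    exact ⟨⟨∅, fun _ => 0, fun q hq => absurd hq (Finset.notMem_empty q)⟩, fun j hj => absurd hj (Finset.notMem_empty j),
      fun q hq => absurd hq (Finset.notMem_empty q)⟩
  | insert a s ha ih =>
    obtain ⟨𝒰, h1, h2⟩ := ih
    refine ⟨(𝒟 a).union 𝒰, fun j hj q hq => ?_, fun q hq => ?_⟩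
    · rcases Finset.mem_insert.1 hj with rfl | hj
      · exact ValueDerivation.mem_union_S_left hq
      · exact ValueDerivation.mem_union_S_right (h1 j hj q hq)
    · rcases ValueDerivation.mem_union_S.1 hq with hq | hq
      · exact ⟨a, Finset.mem_insert_self _ _, hq⟩
      · obtain ⟨j, hj, hjq⟩ := h2 q hq
        exact ⟨j, Finset.mem_insert_of_mem hj, hjq⟩

/-- **SUPPORTED SUMS.**  If every `t_j` (`j ∈ s`) is a value of a derivation with supports `≤ k` and the sum `Σ_{j ∈ s} t_j` is fixed by
the pointwise stabiliser of `A` (`|A| ≤ k`), then the sum is a value of a derivation with supports `≤ k`. [folklore] -/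
theorem exists_supported_sum {k : ℕ} {ι : Type*} (s : Finset ι) (t : ι → MvPolynomial (Fin n × Fin n) ℂ)
    (ht : ∀ j ∈ s, ∃ 𝒟 : ValueDerivation ℂ (Fin n × Fin n), t j ∈ 𝒟.S ∧ ∀ q ∈ 𝒟.S, ∃ T' : Finset (Fin n), T'.card ≤ k ∧
      ∀ σ : Perm (Fin n), (∀ i ∈ T', σ i = i) → ren σ q = q)
    (A : Finset (Fin n)) (hA : A.card ≤ k)
    (hfix : ∀ σ : Perm (Fin n), (∀ i ∈ A, σ i = i) → ren σ (∑ j ∈ s, t j) = ∑ j ∈ s, t j) :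
    ∃ 𝒟 : ValueDerivation ℂ (Fin n × Fin n), (∑ j ∈ s, t j) ∈ 𝒟.S ∧ ∀ q ∈ 𝒟.S, ∃ T' : Finset (Fin n), T'.card ≤ k ∧
      ∀ σ : Perm (Fin n), (∀ i ∈ T', σ i = i) → ren σ q = q := by
  choose 𝒟 h𝒟t h𝒟S using ht
  let 𝒟' : ι → ValueDerivation ℂ (Fin n × Fin n) := fun j =>
    if hj : j ∈ s then 𝒟 j hj else ⟨∅, fun _ => 0, fun q hq => absurd hq (Finset.notMem_empty q)⟩
  have h𝒟' : ∀ j (hj : j ∈ s), 𝒟' j = 𝒟 j hj := fun j hj => dif_pos hj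
  obtain ⟨𝒰, hU1, hU2⟩ := exists_union_derivation s 𝒟'
  -- adjoin the weighted sum `Σ_{j ∈ s} 1 · t_j`
  set D : Multiset (ℂ × MvPolynomial (Fin n × Fin n) ℂ) := s.val.map fun j => ((1 : ℂ), t j) with hD
  have hargs : ∀ u ∈ (StepData.sum D).args, u ∈ 𝒰.S := by
    intro u hu
    simp only [StepData.args, hD, Multiset.map_map, Function.comp_def, Multiset.mem_map, Finset.mem_val] at hu
    obtain ⟨j, hj, rfl⟩ := hu
    exact hU1 j hj _ (by rw [h𝒟']; exact h𝒟t j hj)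
  have hval : (StepData.sum D).value = ∑ j ∈ s, t j := by
    simp only [StepData.value, hD, Multiset.map_map, Function.comp_def, C_1, one_mul]
    exact (Finset.sum_eq_multiset_sum s t).symm
  refine ⟨𝒰.adjoin (StepData.sum D) hargs, ?_, fun q hq => ?_⟩
  · rw [← hval]; exact ValueDerivation.value_mem_adjoin_S
  · rcases ValueDerivation.mem_adjoin_S.1 hq with rfl | hq
    · rw [hval]; exact ⟨A, hA, hfix⟩
    · obtain ⟨j, hj, hjq⟩ := hU2 q hq
      rw [h𝒟' j hj] at hjq
      exact h𝒟S j hj q hjq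

/-! ### Power sums within a row / a column -/

/-- The variable `x_P` is the value of a one-step derivation and is fixed by the pointwise stabiliser of `{P.1, P.2}`. [folklore] -/
theorem X_supported (P : Fin n × Fin n) :
    (∀ σ : Perm (Fin n), (∀ i ∈ ({P.1, P.2} : Finset (Fin n)), σ i = i) → ren σ (X P : MvPolynomial (Fin n × Fin n) ℂ) = X P) ∧
    ∃ 𝒟 : ValueDerivation ℂ (Fin n × Fin n), (X P : MvPolynomial (Fin n × Fin n) ℂ) ∈ 𝒟.S ∧
      ∀ q ∈ 𝒟.S, ∃ T' : Finset (Fin n), T'.card ≤ 2 ∧ ∀ σ : Perm (Fin n), (∀ i ∈ T', σ i = i) → ren σ q = q := by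
  have hfix : ∀ σ : Perm (Fin n), (∀ i ∈ ({P.1, P.2} : Finset (Fin n)), σ i = i) →
      ren σ (X P : MvPolynomial (Fin n × Fin n) ℂ) = X P := by
    intro σ hσ
    rw [ren_X]
    congr 1
    exact Prod.ext (by simpa using hσ P.1 (by simp)) (by simpa using hσ P.2 (by simp))
  refine ⟨hfix, ⟨{X P}, fun _ => 0, fun q hq => ⟨StepData.var P, ⟨?_, fun u hu => ?_⟩⟩⟩, Finset.mem_singleton_self _,
    fun q hq => ⟨{P.1, P.2}, Finset.card_le_two, fun σ hσ => ?_⟩⟩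
  · rw [Finset.mem_singleton.1 hq]; rfl
  · exact absurd hu (Multiset.notMem_zero u)
  · rw [Finset.mem_singleton.1 hq]; exact hfix σ hσ

/-- **Row power sums are supported**: `Σ_j x_ij^m` is fixed by the pointwise stabiliser of `{i}` and has a value derivation with
supports `≤ 2`. [folklore] -/
theorem rowPowerSum_supported (i : Fin n) (m : ℕ) :
    (∀ σ : Perm (Fin n), (∀ i' ∈ ({i} : Finset (Fin n)), σ i' = i') →
      ren σ (∑ j : Fin n, (X (i, j) : MvPolynomial (Fin n × Fin n) ℂ) ^ m) = ∑ j : Fin n, X (i, j) ^ m) ∧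
    ∃ 𝒟 : ValueDerivation ℂ (Fin n × Fin n), (∑ j : Fin n, (X (i, j) : MvPolynomial (Fin n × Fin n) ℂ) ^ m) ∈ 𝒟.S ∧
      ∀ q ∈ 𝒟.S, ∃ T' : Finset (Fin n), T'.card ≤ 2 ∧ ∀ σ : Perm (Fin n), (∀ i ∈ T', σ i = i) → ren σ q = q := by
  have hfix : ∀ σ : Perm (Fin n), (∀ i' ∈ ({i} : Finset (Fin n)), σ i' = i') →
      ren σ (∑ j : Fin n, (X (i, j) : MvPolynomial (Fin n × Fin n) ℂ) ^ m) = ∑ j : Fin n, X (i, j) ^ m := by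
    intro σ hσ
    have hi : σ i = i := hσ i (Finset.mem_singleton_self _)
    rw [map_sum]
    simp only [map_pow, ren_X, Prod.smul_mk, Perm.smul_def, hi]
    exact Equiv.sum_comp σ (fun j => (X (i, j) : MvPolynomial (Fin n × Fin n) ℂ) ^ m)
  refine ⟨hfix, ?_⟩
  refine exists_supported_sum (k := 2) Finset.univ (fun j => (X (i, j) : MvPolynomial (Fin n × Fin n) ℂ) ^ m)
    (fun j _ => ?_) {i} (by simp) hfix
  -- `x_ij^m ∈ ℂ[x_ij]`, supported on `{i, j}`
  have h := exists_supported_of_mem_adjoin (k := 2) ({i, j} : Finset (Fin n)) Finset.card_le_two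
    (T := {(X (i, j) : MvPolynomial (Fin n × Fin n) ℂ)}) (fun t ht => by rw [Set.mem_singleton_iff.1 ht]; exact X_supported (i, j))
    (p := (X (i, j) : MvPolynomial (Fin n × Fin n) ℂ) ^ m)
    (Subalgebra.pow_mem _ (Algebra.subset_adjoin (Set.mem_singleton _)) m)
  exact h.2

/-- **Column power sums are supported.** [folklore] -/
theorem colPowerSum_supported (j : Fin n) (m : ℕ) :
    (∀ σ : Perm (Fin n), (∀ j' ∈ ({j} : Finset (Fin n)), σ j' = j') →
      ren σ (∑ i : Fin n, (X (i, j) : MvPolynomial (Fin n × Fin n) ℂ) ^ m) = ∑ i : Fin n, X (i, j) ^ m) ∧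
    ∃ 𝒟 : ValueDerivation ℂ (Fin n × Fin n), (∑ i : Fin n, (X (i, j) : MvPolynomial (Fin n × Fin n) ℂ) ^ m) ∈ 𝒟.S ∧
      ∀ q ∈ 𝒟.S, ∃ T' : Finset (Fin n), T'.card ≤ 2 ∧ ∀ σ : Perm (Fin n), (∀ i ∈ T', σ i = i) → ren σ q = q := by
  have hfix : ∀ σ : Perm (Fin n), (∀ j' ∈ ({j} : Finset (Fin n)), σ j' = j') →
      ren σ (∑ i : Fin n, (X (i, j) : MvPolynomial (Fin n × Fin n) ℂ) ^ m) = ∑ i : Fin n, X (i, j) ^ m := by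
    intro σ hσ
    have hj : σ j = j := hσ j (Finset.mem_singleton_self _)
    rw [map_sum]
    simp only [map_pow, ren_X, Prod.smul_mk, Perm.smul_def, hj]
    exact Equiv.sum_comp σ (fun i => (X (i, j) : MvPolynomial (Fin n × Fin n) ℂ) ^ m)
  refine ⟨hfix, ?_⟩
  refine exists_supported_sum (k := 2) Finset.univ (fun i => (X (i, j) : MvPolynomial (Fin n × Fin n) ℂ) ^ m)
    (fun i _ => ?_) {j} (by simp) hfix
  have h := exists_supported_of_mem_adjoin (k := 2) ({i, j} : Finset (Fin n)) Finset.card_le_two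
    (T := {(X (i, j) : MvPolynomial (Fin n × Fin n) ℂ)}) (fun t ht => by rw [Set.mem_singleton_iff.1 ht]; exact X_supported (i, j))
    (p := (X (i, j) : MvPolynomial (Fin n × Fin n) ℂ) ^ m)
    (Subalgebra.pow_mem _ (Algebra.subset_adjoin (Set.mem_singleton _)) m)
  exact h.2

/-! ### Power sums of an equivariant row-local family are restorable -/

/-- `(n+1)^8 ≤ 2^((log₂ n + 9)^9)`. [folklore] -/
theorem pow_eight_le_bound (n : ℕ) : (n + 1) ^ 8 ≤ 2 ^ ((Nat.log 2 n + 9) ^ 9) := by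
  have hL : n < 2 ^ (Nat.log 2 n + 1) := Nat.lt_pow_succ_log_self Nat.one_lt_two n
  generalize Nat.log 2 n = L at hL ⊢
  have h1 : n + 1 ≤ 2 ^ (L + 1) := hL
  calc (n + 1) ^ 8 ≤ (2 ^ (L + 1)) ^ 8 := Nat.pow_le_pow_left h1 8
    _ = 2 ^ (8 * (L + 1)) := by rw [← pow_mul, mul_comm]
    _ ≤ 2 ^ ((L + 9) ^ 9) := by
        refine Nat.pow_le_pow_right (by norm_num) ?_
        calc 8 * (L + 1) ≤ (L + 9) * (L + 9) := by nlinarith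
          _ = (L + 9) ^ 2 := (sq _).symm
          _ ≤ (L + 9) ^ 9 := Nat.pow_le_pow_right (by omega) (by omega)

/-- **Power sums of an equivariant row-local family.**  If `σ · v_i = v_{σ i}` and every `v_i` is a polynomial in the power sums
`Σ_j x_ij^m` of row `i`, then every power sum `Σ_i v_i^e` is `QPOrbitRestorable 9 n`. [folklore] -/
theorem twoLevel_powerSum_qpOrbitRestorable (v : Fin n → MvPolynomial (Fin n × Fin n) ℂ)
    (hv : ∀ (σ : Perm (Fin n)) (i : Fin n), ren σ (v i) = v (σ i))
    (hmem : ∀ i : Fin n, v i ∈ Algebra.adjoin ℂ (Set.range fun m : ℕ => ∑ j : Fin n, (X (i, j) : MvPolynomial (Fin n × Fin n) ℂ) ^ m))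
    (e : ℕ) : QPOrbitRestorable 9 n (∑ i : Fin n, v i ^ e) := by
  have hfix : ∀ σ : Perm (Fin n), ren σ (∑ i : Fin n, v i ^ e) = ∑ i : Fin n, v i ^ e := by
    intro σ
    rw [map_sum]; simp only [map_pow, hv]; exact Equiv.sum_comp σ (fun i => v i ^ e)
  -- each `v_i^e` has a derivation with supports `≤ 2`
  have hsupp : ∀ i ∈ (Finset.univ : Finset (Fin n)), ∃ 𝒟 : ValueDerivation ℂ (Fin n × Fin n), v i ^ e ∈ 𝒟.S ∧
      ∀ q ∈ 𝒟.S, ∃ T' : Finset (Fin n), T'.card ≤ 2 ∧ ∀ σ : Perm (Fin n), (∀ i ∈ T', σ i = i) → ren σ q = q := by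
    intro i _
    have h := exists_supported_of_mem_adjoin (k := 2) ({i} : Finset (Fin n)) (by simp)
      (T := Set.range fun m : ℕ => ∑ j : Fin n, (X (i, j) : MvPolynomial (Fin n × Fin n) ℂ) ^ m)
      (by rintro _ ⟨m, rfl⟩; exact rowPowerSum_supported i m)
      (p := v i ^ e) (Subalgebra.pow_mem _ (hmem i) e)
    exact h.2
  obtain ⟨𝒟, hmemD, hS⟩ := exists_supported_sum (k := 2) Finset.univ (fun i => v i ^ e) hsupp ∅ (by simp)
    (fun σ _ => hfix σ)
  obtain ⟨G, inst, C, hC, hev, horb⟩ := ValueOrbit.qpOrbit_of_supportedDerivation 𝒟 hmemD hfix hS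
  exact ⟨G, inst, C, hC, hev, horb.trans (pow_eight_le_bound n)⟩

/-- The column version. [folklore] -/
theorem twoLevel_colPowerSum_qpOrbitRestorable (w : Fin n → MvPolynomial (Fin n × Fin n) ℂ)
    (hw : ∀ (σ : Perm (Fin n)) (j : Fin n), ren σ (w j) = w (σ j))
    (hmem : ∀ j : Fin n, w j ∈ Algebra.adjoin ℂ (Set.range fun m : ℕ => ∑ i : Fin n, (X (i, j) : MvPolynomial (Fin n × Fin n) ℂ) ^ m))
    (e : ℕ) : QPOrbitRestorable 9 n (∑ j : Fin n, w j ^ e) := by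
  have hfix : ∀ σ : Perm (Fin n), ren σ (∑ j : Fin n, w j ^ e) = ∑ j : Fin n, w j ^ e := by
    intro σ
    rw [map_sum]; simp only [map_pow, hw]; exact Equiv.sum_comp σ (fun j => w j ^ e)
  have hsupp : ∀ j ∈ (Finset.univ : Finset (Fin n)), ∃ 𝒟 : ValueDerivation ℂ (Fin n × Fin n), w j ^ e ∈ 𝒟.S ∧
      ∀ q ∈ 𝒟.S, ∃ T' : Finset (Fin n), T'.card ≤ 2 ∧ ∀ σ : Perm (Fin n), (∀ i ∈ T', σ i = i) → ren σ q = q := by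
    intro j _
    have h := exists_supported_of_mem_adjoin (k := 2) ({j} : Finset (Fin n)) (by simp)
      (T := Set.range fun m : ℕ => ∑ i : Fin n, (X (i, j) : MvPolynomial (Fin n × Fin n) ℂ) ^ m)
      (by rintro _ ⟨m, rfl⟩; exact colPowerSum_supported j m)
      (p := w j ^ e) (Subalgebra.pow_mem _ (hmem j) e)
    exact h.2
  obtain ⟨𝒟, hmemD, hS⟩ := exists_supported_sum (k := 2) Finset.univ (fun j => w j ^ e) hsupp ∅ (by simp)
    (fun σ _ => hfix σ)
  obtain ⟨G, inst, C, hC, hev, horb⟩ := ValueOrbit.qpOrbit_of_supportedDerivation 𝒟 hmemD hfix hS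
  exact ⟨G, inst, C, hC, hev, horb.trans (pow_eight_le_bound n)⟩

/-! ### The two-level row/column stratum -/

/-- Newton in `ℂ[y_0, …, y_{n-1}]`: `e_k ∈ ℂ[p_m : m ∈ ℕ]` for `k ≤ n` (cf. `NewtonProdPsum.esymm_mem_adjoin_psum`, generators indexed
by `Fin n` there). [folklore] -/
theorem esymm_mem_adjoin_psum_range {k : ℕ} (hk : k ≤ n) :
    esymm (Fin n) ℂ k ∈ Algebra.adjoin ℂ (Set.range fun m : ℕ => psum (Fin n) ℂ m) := by
  induction k using Nat.strong_induction_on with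
  | _ k ih =>
    rcases Nat.eq_zero_or_pos k with rfl | hpos
    · rw [esymm_zero]; exact Subalgebra.one_mem _
    have hk0 : (k : ℂ) ≠ 0 := Nat.cast_ne_zero.mpr hpos.ne'
    have key := MvPolynomial.mul_esymm_eq_sum (Fin n) ℂ k
    have hCk : esymm (Fin n) ℂ k = (k : ℂ)⁻¹ • ((k : MvPolynomial (Fin n) ℂ) * esymm (Fin n) ℂ k) := by
      rw [smul_eq_C_mul, ← mul_assoc, show (k : MvPolynomial (Fin n) ℂ) = C (k : ℂ) from (map_natCast C k).symm,
        ← map_mul, inv_mul_cancel₀ hk0, C_1, one_mul]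
    have hneg : ∀ i : ℕ, (-1 : MvPolynomial (Fin n) ℂ) ^ i ∈
        Algebra.adjoin ℂ (Set.range fun m : ℕ => psum (Fin n) ℂ m) := fun i =>
      Subalgebra.pow_mem _ (Subalgebra.neg_mem _ (Subalgebra.one_mem _)) _
    rw [hCk, key]
    refine Subalgebra.smul_mem _ (Subalgebra.mul_mem _ (hneg _) (Subalgebra.sum_mem _ fun a ha => ?_)) _
    rw [Finset.mem_filter, Finset.HasAntidiagonal.mem_antidiagonal] at ha
    obtain ⟨hab, halt⟩ := ha
    refine Subalgebra.mul_mem _ (Subalgebra.mul_mem _ (hneg _) (ih a.1 halt (by omega))) ?_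
    exact Algebra.subset_adjoin ⟨a.2, rfl⟩

/-- **A symmetric polynomial is a polynomial in the power sums** (fundamental theorem, Mathlib `esymmAlgHom_surjective`, + Newton).
[folklore] -/
theorem mem_adjoin_psum_of_isSymmetric {g : MvPolynomial (Fin n) ℂ} (hg : g.IsSymmetric) :
    g ∈ Algebra.adjoin ℂ (Set.range fun m : ℕ => psum (Fin n) ℂ m) := by
  obtain ⟨Q, hQ⟩ := esymmAlgHom_surjective ℂ (σ := Fin n) (n := n) (by simp) ⟨g, (mem_symmetricSubalgebra g).2 hg⟩
  have hQ' : aeval (fun i : Fin n => esymm (Fin n) ℂ ((i : ℕ) + 1)) Q = g := by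
    simpa only [esymmAlgHom_apply] using congrArg Subtype.val hQ
  have hmem : g ∈ Algebra.adjoin ℂ (Set.range fun i : Fin n => esymm (Fin n) ℂ ((i : ℕ) + 1)) := by
    rw [Algebra.adjoin_range_eq_range_aeval, AlgHom.mem_range]; exact ⟨Q, hQ'⟩
  refine (Algebra.adjoin_le ?_ : Algebra.adjoin ℂ _ ≤ _) hmem
  rintro _ ⟨i, rfl⟩
  exact esymm_mem_adjoin_psum_range (by omega)

/-- **Transport**: for symmetric `g`, `g(v_0, …, v_{n-1}) ∈ ℂ[Σ_i v_i^m : m ∈ ℕ]`. [folklore] -/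
theorem aeval_mem_adjoin_powerSums_of_isSymmetric (v : Fin n → MvPolynomial (Fin n × Fin n) ℂ)
    {g : MvPolynomial (Fin n) ℂ} (hg : g.IsSymmetric) :
    aeval v g ∈ Algebra.adjoin ℂ (Set.range fun m : ℕ => ∑ i : Fin n, v i ^ m) := by
  have h2 : aeval v g ∈ (Algebra.adjoin ℂ (Set.range fun m : ℕ => psum (Fin n) ℂ m)).map (aeval v) :=
    Subalgebra.mem_map.2 ⟨_, mem_adjoin_psum_of_isSymmetric hg, rfl⟩
  rw [AlgHom.map_adjoin, ← Set.range_comp] at h2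
  have hfun : ((aeval v : MvPolynomial (Fin n) ℂ →ₐ[ℂ] MvPolynomial (Fin n × Fin n) ℂ) ∘ fun m : ℕ => psum (Fin n) ℂ m) =
      fun m : ℕ => ∑ i : Fin n, v i ^ m := by
    funext m
    simp only [Function.comp_apply, psum, map_sum, map_pow, aeval_X]
  rwa [hfun] at h2

/-- Evaluating a symmetric polynomial at a permuted family. [folklore] -/
theorem aeval_perm_of_isSymmetric {g : MvPolynomial (Fin n) ℂ} (hg : g.IsSymmetric)
    (h : Fin n → MvPolynomial (Fin n × Fin n) ℂ) (τ : Perm (Fin n)) :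
    aeval (fun j => h (τ j)) g = aeval h g := by
  rw [show (fun j => h (τ j)) = h ∘ ⇑τ from rfl, ← aeval_rename, hg τ]

/-- **THE TWO-LEVEL ROW/COLUMN STRATUM.**  For symmetric `g, g' ∈ ℂ[y_0, …, y_{n-1}]`, put `v_i = g(x_i0, …, x_i,n-1)` (row `i`)
and `w_j = g'(x_0j, …, x_n-1,j)` (column `j`).  Every MATRIX-SYMMETRIC element of `ℂ[v_0, …, v_{n-1}, w_0, …, w_{n-1}]` is
`QPOrbitRestorable 12 n`. [folklore] -/
theorem qpOrbitRestorable_twoLevel (g g' : MvPolynomial (Fin n) ℂ) (hg : g.IsSymmetric) (hg' : g'.IsSymmetric)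
    {p : MvPolynomial (Fin n × Fin n) ℂ}
    (hsym : ∀ σ τ : Perm (Fin n), rename (fun q : Fin n × Fin n => (σ q.1, τ q.2)) p = p)
    (hp : p ∈ Algebra.adjoin ℂ
      (Set.range (fun i : Fin n => aeval (fun j : Fin n => (X (i, j) : MvPolynomial (Fin n × Fin n) ℂ)) g) ∪
        Set.range (fun j : Fin n => aeval (fun i : Fin n => (X (i, j) : MvPolynomial (Fin n × Fin n) ℂ)) g'))) :
    QPOrbitRestorable 12 n p := by
  set v : Fin n → MvPolynomial (Fin n × Fin n) ℂ :=
    fun i : Fin n => aeval (fun j : Fin n => (X (i, j) : MvPolynomial (Fin n × Fin n) ℂ)) g with hvdef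
  set w : Fin n → MvPolynomial (Fin n × Fin n) ℂ :=
    fun j : Fin n => aeval (fun i : Fin n => (X (i, j) : MvPolynomial (Fin n × Fin n) ℂ)) g' with hwdef
  -- behaviour under row / column / diagonal renaming
  have hv_col : ∀ (τ : Perm (Fin n)) (i : Fin n), rename (fun q : Fin n × Fin n => (q.1, τ q.2)) (v i) = v i := by
    intro τ i
    simp only [hvdef, MvPolynomial.comp_aeval_apply, rename_X]
    exact aeval_perm_of_isSymmetric hg (fun j => (X (i, j) : MvPolynomial (Fin n × Fin n) ℂ)) τ
  have hw_col : ∀ (τ : Perm (Fin n)) (j : Fin n), rename (fun q : Fin n × Fin n => (q.1, τ q.2)) (w j) = w (τ j) :=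
    fun τ j => by simp only [hwdef, MvPolynomial.comp_aeval_apply, rename_X]
  have hv_row : ∀ (σ : Perm (Fin n)) (i : Fin n), rename (fun q : Fin n × Fin n => (σ q.1, q.2)) (v i) = v (σ i) :=
    fun σ i => by simp only [hvdef, MvPolynomial.comp_aeval_apply, rename_X]
  have hw_row : ∀ (σ : Perm (Fin n)) (j : Fin n), rename (fun q : Fin n × Fin n => (σ q.1, q.2)) (w j) = w j := by
    intro σ j
    simp only [hwdef, MvPolynomial.comp_aeval_apply, rename_X]
    exact aeval_perm_of_isSymmetric hg' (fun i => (X (i, j) : MvPolynomial (Fin n × Fin n) ℂ)) σ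
  have hv_diag : ∀ (σ : Perm (Fin n)) (i : Fin n), ren σ (v i) = v (σ i) := by
    intro σ i
    simp only [hvdef, MvPolynomial.comp_aeval_apply, ren_X, Prod.smul_mk, Perm.smul_def]
    exact aeval_perm_of_isSymmetric hg (fun j => (X (σ i, j) : MvPolynomial (Fin n × Fin n) ℂ)) σ
  have hw_diag : ∀ (σ : Perm (Fin n)) (j : Fin n), ren σ (w j) = w (σ j) := by
    intro σ j
    simp only [hwdef, MvPolynomial.comp_aeval_apply, ren_X, Prod.smul_mk, Perm.smul_def]
    exact aeval_perm_of_isSymmetric hg' (fun i => (X (i, σ j) : MvPolynomial (Fin n × Fin n) ℂ)) σ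
  -- Step 1: symmetrise the columns over `ℂ[v]`
  have h1 := RowColumnStratum.mem_adjoin_esymm_of_symmetric (Set.range v) w
    (fun τ => rename (fun q : Fin n × Fin n => (q.1, τ q.2)))
    (by rintro τ _ ⟨i, rfl⟩; exact hv_col τ i) (fun τ j => hw_col τ j)
    (fun τ => by simpa only [Perm.coe_one, id_eq] using hsym 1 τ) hp
  -- Step 2: symmetrise the rows over `ℂ[e(w)]`
  rw [Set.union_comm] at h1
  have h2 := RowColumnStratum.mem_adjoin_esymm_of_symmetric
    (Set.range fun k : Fin n => aeval w (esymm (Fin n) ℂ ((k : ℕ) + 1))) v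
    (fun σ => rename (fun q : Fin n × Fin n => (σ q.1, q.2)))
    (by
      rintro σ _ ⟨k, rfl⟩
      rw [MvPolynomial.comp_aeval_apply]
      simp only [hw_row])
    (fun σ i => hv_row σ i)
    (fun σ => by simpa only [Perm.coe_one, id_eq] using hsym σ 1) h1
  -- Step 3: Newton; Step 4: restorable generators; Step 5: flat-cost closure
  refine RowColumnRestorable.qpOrbitRestorable_of_mem_adjoin (c := 9)
    (T := (Set.range fun e : ℕ => ∑ j : Fin n, w j ^ e) ∪ Set.range fun e : ℕ => ∑ i : Fin n, v i ^ e) ?_ ?_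
  · rintro t (⟨e, rfl⟩ | ⟨e, rfl⟩)
    · exact twoLevel_colPowerSum_qpOrbitRestorable w hw_diag
        (fun j => aeval_mem_adjoin_powerSums_of_isSymmetric (fun i : Fin n => (X (i, j) : MvPolynomial (Fin n × Fin n) ℂ)) hg') e
    · exact twoLevel_powerSum_qpOrbitRestorable v hv_diag
        (fun i => aeval_mem_adjoin_powerSums_of_isSymmetric (fun j : Fin n => (X (i, j) : MvPolynomial (Fin n × Fin n) ℂ)) hg) e
  · refine (Algebra.adjoin_le ?_ : Algebra.adjoin ℂ _ ≤ _) h2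
    rintro t (⟨k, rfl⟩ | ⟨k, rfl⟩)
    · have h := RowColumnStratum.aeval_esymm_mem_adjoin_powerSums w (k := (k : ℕ) + 1) (by omega)
      refine (Algebra.adjoin_mono ?_) h
      rintro _ ⟨m, rfl⟩
      exact Or.inl ⟨m, rfl⟩
    · have h := RowColumnStratum.aeval_esymm_mem_adjoin_powerSums v (k := (k : ℕ) + 1) (by omega)
      refine (Algebra.adjoin_mono ?_) h
      rintro _ ⟨m, rfl⟩
      exact Or.inr ⟨m, rfl⟩

end RowColumnTwoLevel

end Summit.ValiantsHypothesis.ValiantsHypothesis.Theorems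

end
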